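import Mathlib
import HarnessLib
import Summits.ValiantsHypothesis.ValiantsHypothesis.Theorems.SymmetryDialPairKeyedScheme

/-!
# Symmetry dial — pair keys are INERT with at most one pebbled dual (NODE-g10, answer to bus Q-K8)

The pair-keyed scheme `protPK = protKey ∪ PK` differs from the keyed scheme `protKey` only through
`pairKeyed D β₁ β₂`, which demands two DISTINCT pebbled duals `β₁ ≠ β₂`.  Hence on every position
carrying at most one pebbled dual functional the two schemes coincide — so every certificate cell
with `|B| ≤ 1` (classes `(t, 0)` and `(t, 1)`: the point half K7, and K8's `exc2` = `(2,1,p)`,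
`k11` = `(1,1,·)`, canary `(2,1,b)`), whose configuration AND predecessor configuration both have
`|B| ≤ 1`, has literally the same protected rows, KEEP set and rank test under both schemes.
-/

set_option linter.dupNamespace false

namespace Summit.ValiantsHypothesis.ValiantsHypothesis.Theorems.SymmetryDialPairKeyedInert

open SymmetryDialAffinePebble (V)
open SymmetryDialDisalignedCFI (Design)
open SymmetryDialShearInvariant (Pos)
open SymmetryDialCondScheme (dualPeb)
open SymmetryDialKeyedScheme (protKey)
open SymmetryDialPairKeyedScheme (pairKeyed protPK)

variable {d₀ r δ : ℕ}

/-- A pair key needs two distinct functionals. -/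
theorem pairKeyed_ne (D : Design d₀ r δ) (β₁ β₂ : V r) (v w : V d₀)
    (h : pairKeyed D β₁ β₂ v w = true) : β₁ ≠ β₂ := by
  unfold pairKeyed at h
  rw [decide_eq_true_eq] at h
  exact h.1

/-- **Inertness.** If the position `s` carries at most one pebbled dual functional, the pair-keyed
scheme and the keyed scheme protect exactly the same edges. -/
theorem protPK_eq_protKey_of_atMostOneDual {k : ℕ} (D : Design d₀ r δ) (s : Pos k (d₀ + r))
    (hs : ∀ β₁ β₂ : V r, dualPeb s β₁ = true → dualPeb s β₂ = true → β₁ = β₂) (v w : V d₀) :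
    protPK k D s v w = protKey k D s v w := by
  unfold protPK
  have hno : decide (∃ β₁ β₂ : V r, dualPeb s β₁ = true ∧ dualPeb s β₂ = true ∧
      (pairKeyed D β₁ β₂ v w = true ∨ pairKeyed D β₁ β₂ w v = true)) = false := by
    rw [decide_eq_false_iff_not]
    rintro ⟨β₁, β₂, h₁, h₂, hk⟩
    have hne : β₁ ≠ β₂ := by
      rcases hk with hk | hk
      · exact pairKeyed_ne D β₁ β₂ v w hk
      · exact pairKeyed_ne D β₁ β₂ w v hk
    exact hne (hs β₁ β₂ h₁ h₂)
  rw [hno, Bool.or_false]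

/-- In particular with NO pebbled dual (all point configurations, the K7 point half). -/
theorem protPK_eq_protKey_of_noDual {k : ℕ} (D : Design d₀ r δ) (s : Pos k (d₀ + r))
    (hs : ∀ β : V r, dualPeb s β = false) (v w : V d₀) :
    protPK k D s v w = protKey k D s v w :=
  protPK_eq_protKey_of_atMostOneDual D s (fun β₁ _ h₁ _ => by rw [hs β₁] at h₁; exact absurd h₁ Bool.false_ne_true) v w

end Summit.ValiantsHypothesis.ValiantsHypothesis.Theorems.SymmetryDialPairKeyedInert
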